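import Summits.Ventures.PercRepro.RankLevelSetLevelSix
import Summits.Ventures.PercRepro.RankLevelSetLevelFiveAll

/-!
# PercRepro — S3: THE `q = 6` WINDOW OF C-025, CELL BY CELL (p8, sub-claim owner; ACCELERATION ADDENDUM)

The sub-claim S3 of the crux of record (`PLAN.md` §ACCELERATION): `C025` at level `6` for the explicit window
`8 ≤ p ≤ 124425`, every finite matroid, unbounded corank — the complement, `p ≥ 124426`, is THEOREM C₆
(`c025_six_large`, RankLevelSetLevelSixAll). This module states S3 as a `Prop` (`S3Window`) and proves the
EXACT cell structure the cell's own wrapper gives it: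

* **`rls_succ_large_at`** — the per-rank form of night-1's threshold wrapper `rls_succ_large`
  (RankLevelSetFrameLarge): level `q + 1` at ONE rank `p₀` from level `q` at `p₀ − 1` (all matroids), level
  `q + 1` at corank `≤ D` (`hsmall`) and the `e`-free core at rank `p₀`, corank `> D` (`hcore`). The proof is
  `rls_succ_large`'s `|E|`-induction, which never changes `p`: deletion and truncation keep the rank,
  the only contraction lowers it to `p₀ − 1` at level `q`.
* **`rls_six_at_of_core`** — at level `6` with `D = 6` the `hsmall` half is free (`U = ∅` below corank `6`,
  Theorem M at corank `6`), so: level `6` at `p₀ ≥ 9` ⇐ level `5` at `p₀ − 1` + the `e`-free core at `(p₀, d)`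
  for every corank `d ≥ 7`.
* **`rls_six_at_of_open_cells`** — the core cells already in the tree are removed: corank `≥ 51` is
  `c025_core_six_fortythree` once `p₀ ≥ 81`; coranks `7 … 50` are `c025_core_six_bounded_corank` once
  `p₀ ≥ 124425`. What is left at `p₀` is EXACTLY: level `5` at `p₀ − 1` (of record for `p₀ ≥ 836`,
  `c025_five_large`), the core cells `(p₀, d)` with `7 ≤ d ≤ 50` for `p₀ ≤ 124424`, and the core cells
  `(p₀, d ≥ 51)` for `p₀ ≤ 80`.
* **`s3Window_of_cells`** — S3 ⇐ the `(8, 6)` cell + those open cells for every `9 ≤ p₀ ≤ 124425`;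
  **`c025_six_row_of_s3Window`** — S3 + THEOREM C₆ = the whole `q = 6` row.
No new mathematics: this is the bookkeeping of the gap of record at `q = 6` as kernel statements, so that every
cell closed later (a sharper per-corank threshold, the `(8, 6)` assembly, the `q = 5` row) discharges a named
hypothesis. Axioms: standard.
-/

open scoped Matroid

namespace PercRepro

namespace ThmN

variable {α : Type}

/-- **The threshold wrapper at ONE rank**: from level `q` at rank `p₀ − 1` for all finite matroids (`hprev`),
level `q + 1` at rank `p₀` and corank `≤ D` (`hsmall`), and the `e`-free core at rank `p₀`, corank `> D`
(`hcore`), level `q + 1` at rank `p₀` for every finite matroid. Same proof as `rls_succ_large`, with `p` fixed. -/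
theorem rls_succ_large_at (q D p₀ : ℕ) (hp : q + 3 ≤ p₀)
    (hprev : ∀ (M : Matroid α) [M.Finite], RLS M (p₀ - 1) q)
    (hsmall : ∀ (M : Matroid α) [M.Finite], M.E.ncard ≤ p₀ + D → RLS M p₀ (q + 1))
    (hcore : ∀ (M : Matroid α) [M.Finite], M.eRank = (p₀ : ℕ∞) → p₀ + D < M.E.ncard →
      (∀ e ∈ M.E, ∃ A ⊆ M.E \ {e}, e ∉ M.closure A ∧ e ∉ M.closure ((M.E \ {e}) \ A)) →
      RLS M p₀ (q + 1)) :
    ∀ (M : Matroid α) [M.Finite], RLS M p₀ (q + 1) := by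
  suffices H : ∀ n : ℕ, ∀ (M : Matroid α) [M.Finite], M.E.ncard = n → RLS M p₀ (q + 1) from
    fun M _ => H _ M rfl
  intro n
  induction n using Nat.strong_induction_on with
  | _ n ih =>
  intro M _ hn
  classical
  -- Case 0: bounded corank
  by_cases hD : n ≤ p₀ + D
  · exact hsmall M (by omega)
  push Not at hD
  have hdel : ∀ e ∈ M.E, (M ＼ {e}).E.ncard < n := by
    intro e he
    rw [_root_.Matroid.delete_ground, ← hn, ← Set.ncard_sdiff_singleton_add_one he M.ground_finite]
    omega
  -- Case 1: a loop (same rank, one element fewer)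
  by_cases hL : ∃ e ∈ M.E, M.IsLoop e
  · obtain ⟨e, he, hloopE⟩ := hL
    exact RLS_of_loop_q M hloopE p₀ (q + 1) (ih _ (hdel e he) (M ＼ {e}) rfl)
  push Not at hL
  -- Case 2: loopless, rank `p₀` — an element without an `e`-free partition closes the step; otherwise the core.
  have hrank : ∀ (N : Matroid α) [N.Finite], N.E = M.E → N.eRank = (p₀ : ℕ∞) → (∀ e ∈ N.E, N.Indep {e}) →
      RLS N p₀ (q + 1) := by
    intro N _ hNE hNR hNI
    by_cases hU : ∃ e ∈ N.E, ∀ A ⊆ N.E \ {e}, e ∈ N.closure A ∨ e ∈ N.closure ((N.E \ {e}) \ A)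
    · obtain ⟨e, he, hunsp⟩ := hU
      have hdelN : (N ＼ {e}).E.ncard < n := by
        rw [_root_.Matroid.delete_ground, hNE, ← hn,
          ← Set.ncard_sdiff_singleton_add_one (hNE ▸ he) M.ground_finite]
        omega
      obtain ⟨p', hp'⟩ : ∃ p', p₀ = p' + 1 := ⟨p₀ - 1, by omega⟩
      have hprev' : RLS (N ／ {e}) p' q := by
        have := hprev (N ／ {e})
        rwa [show p₀ - 1 = p' by omega] at this
      have h1 : RLS (N ＼ {e}) (p' + 1) (q + 1) := by
        have := ih _ hdelN (N ＼ {e}) rfl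
        rwa [hp'] at this
      have := RLS_of_unspanned_q N (hNI e he) hunsp h1 hprev'
      rwa [← hp'] at this
    · push Not at hU
      refine hcore N hNR (by rw [hNE, hn]; omega) (fun e he => ?_)
      obtain ⟨A, hA, h⟩ := hU e he
      exact ⟨A, hA, h.1, h.2⟩
  have hMI : ∀ e ∈ M.E, M.Indep {e} :=
    fun e he => _root_.Matroid.indep_singleton.2 ((_root_.Matroid.not_isLoop_iff he).1 (hL e he))
  rcases lt_trichotomy M.eRank (p₀ : ℕ∞) with hlt | heq | hgt
  · exact RLS_of_eRank_lt M hlt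
  · exact hrank M rfl heq hMI
  · -- `r(E) > p₀`: truncate to rank `p₀` (same ground set, same size; singletons stay independent)
    set T := Matroid.truncate M p₀ with hTdef
    have hTR := truncate_eRank_eq M hgt
    have hTE : T.E = M.E := Matroid.truncate_ground M p₀
    have hTI : ∀ e ∈ T.E, T.Indep {e} := by
      intro e he
      have heM : e ∈ M.E := hTE ▸ he
      rw [Matroid.truncate_indep_iff]
      refine ⟨hMI e heM, ?_⟩
      rw [Set.ncard_singleton]; omega
    have hT : RLS T p₀ (q + 1) := hrank T hTE hTR hTI
    unfold RLS at hT ⊢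
    exact Matroid.rls_of_truncate M p₀ (by omega) (phiK p₀ (q + 1)) (by unfold phiK; positivity) hT

/-- The `e`-free core condition (every element has an `e`-free partition of `E ∖ {e}`), named. -/
def EFree (M : Matroid α) : Prop :=
  ∀ e ∈ M.E, ∃ A ⊆ M.E \ {e}, e ∉ M.closure A ∧ e ∉ M.closure ((M.E \ {e}) \ A)

/-- **The cell structure of level `6` at one rank**: for `p₀ ≥ 9`, level `6` at `p₀` follows from level `5` at
`p₀ − 1` (every finite matroid) and the `e`-free core at `(p₀, d)` for every corank `d ≥ 7` — the coranks
`d ≤ 5` have `U = ∅`, the corank `6` is Theorem M. -/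
theorem rls_six_at_of_core (p₀ : ℕ) (hp : 9 ≤ p₀)
    (h5 : ∀ (M : Matroid α) [M.Finite], RLS M (p₀ - 1) 5)
    (hcore : ∀ (M : Matroid α) [M.Finite] (d : ℕ), 7 ≤ d → M.eRank = (p₀ : ℕ∞) → M.E.ncard = p₀ + d →
      EFree M → RLS M p₀ 6) :
    ∀ (M : Matroid α) [M.Finite], RLS M p₀ 6 := by
  refine rls_succ_large_at (α := α) 5 6 p₀ (by omega) h5 ?_ ?_
  · -- corank `≤ 6`: `U = ∅` or Theorem M
    intro M _ hn
    rcases Nat.lt_or_ge M.E.ncard (p₀ + 6) with h | h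
    · exact RLS_of_ncard_lt M h
    · exact RLS_of_ncard_eq M (by omega)
  · -- the core at corank `≥ 7`
    intro M _ hR hbig hfree
    exact hcore M (M.E.ncard - p₀) (by omega) hR (by omega) hfree

/-- **The OPEN cells of S3 at rank `p₀`** (the tree's core theorems removed): level `6` at `p₀ ≥ 9` follows from
level `5` at `p₀ − 1`, the `e`-free core cells `(p₀, d)` with `7 ≤ d ≤ 50` when `p₀ < 124425`
(`c025_core_six_bounded_corank` covers `p₀ ≥ 124425`), and the cells `(p₀, d)` with `d ≥ 51` when `p₀ < 81`
(`c025_core_six_fortythree` covers `p₀ ≥ 81`). -/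
theorem rls_six_at_of_open_cells (p₀ : ℕ) (hp : 9 ≤ p₀)
    (h5 : ∀ (M : Matroid α) [M.Finite], RLS M (p₀ - 1) 5)
    (hmid : ∀ (M : Matroid α) [M.Finite] (d : ℕ), 7 ≤ d → d ≤ 50 → p₀ < 124425 →
      M.eRank = (p₀ : ℕ∞) → M.E.ncard = p₀ + d → EFree M → RLS M p₀ 6)
    (hbig : ∀ (M : Matroid α) [M.Finite] (d : ℕ), 51 ≤ d → p₀ < 81 →
      M.eRank = (p₀ : ℕ∞) → M.E.ncard = p₀ + d → EFree M → RLS M p₀ 6) :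
    ∀ (M : Matroid α) [M.Finite], RLS M p₀ 6 := by
  refine rls_six_at_of_core p₀ hp h5 ?_
  intro M _ d hd hR hn hfree
  rcases Nat.lt_or_ge d 51 with hd50 | hd51
  · rcases Nat.lt_or_ge p₀ 124425 with hsmall | hlarge
    · exact hmid M d hd (by omega) hsmall hR hn hfree
    · exact c025_core_six_bounded_corank M p₀ d hlarge hd (by omega) hR hn hfree
  · rcases Nat.lt_or_ge p₀ 81 with hsmall | hlarge
    · exact hbig M d hd51 hsmall hR hn hfree
    · exact c025_core_six_fortythree M p₀ hlarge hR (by omega) hfree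

end ThmN

/-- **S3 — the `q = 6` window of the crux of record**: `C025` at level `6` for every finite matroid and every
`8 ≤ p ≤ 124425` (the complement `p ≥ 124426` is THEOREM C₆ `ThmN.c025_six_large`, in the tree). -/
def S3Window : Prop :=
  ∀ {α : Type} (M : Matroid α) [M.Finite] (p : ℕ), 8 ≤ p → p ≤ 124425 → ThmN.RLS M p 6

/-- S3 + THEOREM C₆ = the whole `q = 6` row of `C025` (every finite matroid, every `p ≥ 8`). -/
theorem c025_six_row_of_s3Window (h : S3Window) :
    ∀ {α : Type} (M : Matroid α) [M.Finite] (p : ℕ), 8 ≤ p → ThmN.RLS M p 6 := by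
  intro α M _ p hp
  rcases Nat.lt_or_ge p 124426 with hlt | hge
  · exact h M p hp (by omega)
  · exact ThmN.c025_six_of_five (fun M _ p hp => ThmN.c025_five_large M p hp) M p hge

/-- The `q = 6` row in the vocabulary of `C025` (the set-builder body), from S3. -/
theorem c025_six_row_of_s3Window' (h : S3Window) {α : Type} (M : Matroid α) [M.Finite] (p : ℕ) (hp : 8 ≤ p) :
    phiK p 6 * ({A : Set α | A ⊆ M.E ∧ M.eRk A = (p : ℕ∞) ∧ M.eRk (M.E \ A) = (6 : ℕ∞)}.ncard : ℚ) ≤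
      ({A : Set α | A ⊆ M.E ∧ (6 : ℕ∞) < M.eRk A ∧ M.eRk A < (p : ℕ∞)}.ncard : ℚ) :=
  c025_six_row_of_s3Window h M p hp

/-- **S3 FROM ITS CELLS**: the `(8, 6)` cell, and at every `9 ≤ p₀ ≤ 124425` level `5` at `p₀ − 1` together with
the open `e`-free core cells of `rls_six_at_of_open_cells`. With `ThmN.c025_five_large` (level `5` for
`p ≥ 835`) the level-`5` hypothesis is needed only for `p₀ ≤ 835` — see `s3Window_of_cells'`. -/
theorem s3Window_of_cells
    (h86 : ∀ {α : Type} (M : Matroid α) [M.Finite], ThmN.RLS M 8 6)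
    (h5 : ∀ {α : Type} (M : Matroid α) [M.Finite] (p₀ : ℕ), 9 ≤ p₀ → p₀ ≤ 124425 → ThmN.RLS M (p₀ - 1) 5)
    (hmid : ∀ {α : Type} (M : Matroid α) [M.Finite] (p₀ d : ℕ), 9 ≤ p₀ → p₀ < 124425 → 7 ≤ d → d ≤ 50 →
      M.eRank = (p₀ : ℕ∞) → M.E.ncard = p₀ + d → ThmN.EFree M → ThmN.RLS M p₀ 6)
    (hbig : ∀ {α : Type} (M : Matroid α) [M.Finite] (p₀ d : ℕ), 9 ≤ p₀ → p₀ < 81 → 51 ≤ d →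
      M.eRank = (p₀ : ℕ∞) → M.E.ncard = p₀ + d → ThmN.EFree M → ThmN.RLS M p₀ 6) :
    S3Window := by
  intro α M _ p hp8 hp
  rcases Nat.lt_or_ge p 9 with h8 | h9
  · have : p = 8 := by omega
    subst this
    exact h86 M
  · exact ThmN.rls_six_at_of_open_cells (α := α) p h9 (fun M _ => h5 M p h9 hp)
      (fun M _ d hd hd50 hsm hR hn hf => hmid M p d h9 hsm hd hd50 hR hn hf)
      (fun M _ d hd51 hsm hR hn hf => hbig M p d h9 hsm hd51 hR hn hf) M

/-- `s3Window_of_cells` with the level-`5` row of record (`c025_five_large`, `p ≥ 835`) folded in: level `5` is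
needed only at `8 ≤ p₀ − 1 ≤ 834`, i.e. the S2 window. -/
theorem s3Window_of_cells'
    (h86 : ∀ {α : Type} (M : Matroid α) [M.Finite], ThmN.RLS M 8 6)
    (h5 : ∀ {α : Type} (M : Matroid α) [M.Finite] (p : ℕ), 8 ≤ p → p ≤ 834 → ThmN.RLS M p 5)
    (hmid : ∀ {α : Type} (M : Matroid α) [M.Finite] (p₀ d : ℕ), 9 ≤ p₀ → p₀ < 124425 → 7 ≤ d → d ≤ 50 →
      M.eRank = (p₀ : ℕ∞) → M.E.ncard = p₀ + d → ThmN.EFree M → ThmN.RLS M p₀ 6)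
    (hbig : ∀ {α : Type} (M : Matroid α) [M.Finite] (p₀ d : ℕ), 9 ≤ p₀ → p₀ < 81 → 51 ≤ d →
      M.eRank = (p₀ : ℕ∞) → M.E.ncard = p₀ + d → ThmN.EFree M → ThmN.RLS M p₀ 6) :
    S3Window := by
  refine s3Window_of_cells h86 ?_ hmid hbig
  intro α M _ p₀ hp9 _
  rcases Nat.lt_or_ge (p₀ - 1) 835 with hlt | hge
  · exact h5 M (p₀ - 1) (by omega) (by omega)
  · exact ThmN.c025_five_large M (p₀ - 1) hge

end PercRepro
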